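import Summits.QuantumFields.YangMills.Theorems.AlphaInputsT3ACv3SphereAxialGaugeDisc
import HarnessLib

/-!
# `AlphaInputsT3ACv3SphereAxialGaugeRing` — non-abelian (FL), START v3 row (S3), part 2: **THE TOP RING OF THE LATTICE CUBE: COLUMN TRANSPORTS, THE MISMATCH AND ITS SIZE** — on the model
# box `[−R,R]³ ⊂ ℤ³` (any gauge group with the `dist1` interface), the top face `z = R` is reached by COLUMN transports `σ_col` from its edge `y = −R`; against the five-face tree gauge
# `σ_T` of part 1 this defines the RING MISMATCH `ν := σ_T·σ_col⁻¹`, equal to `1` on the edge `y = −R`, moving by ONE thin gauged bond per column step (`≤ 2R·b`) and by one thin gauged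
# bond plus one thin RUNG per row step (`≤ 8R·b` on the edge `y = R`), hence `dist1(ν) ≤ 5·(2R)²·b` all around the ring — cell `ym3-torus`, width seat `ym-ust-19936-w5` (g2), row (S3)
# of ★w1-19936 g2 LEAD memo `NONABELIAN-FL-START-w1-g2.md` §3 (B)∕§4

WHY (OWNER RULING 19936 (FL) START 2026-08-28T02:16:33Z; LEAD memo §3 (B) «comb-axial gauge `σ` on the lattice sphere `∂Q` (`|mlog data^σ| ≤ 6R·b` per bond — uniformly small)»).  No TREE
gauge is uniformly `O(R·b)`-flat on the closed surface (LOCATED, this seat 03:0xZ: a centroid edge of the dual tree bounds `Θ(R²)` plaquettes on either side); the boundary gauge of record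
is the five-face tree (part 1) plus a SPREADING of the top-face mismatch (part 3, matrices).  THIS FILE is the group bookkeeping of that mismatch, in offsets `(a, s)` from the corner
(`N = 2R`): §2 `sigmaCol`, `nu`, `rung` (defs), `sigmaCol_succ`∕`gaugedCol_eq_one`, `nu_zero_s`, ★ `dist1_rung_le` (`≤ s·b + 2R·b`: a top-face `(y,x)`-ladder conjugated by `σ_T`, times
the gauged ring bond below it), `nu_succ_s_mul_inv`∕`nu_succ_a_mul_inv` (the two step identities), `dist1_nu_succ_s_le` (`≤ 2R·b`), `dist1_nu_succ_a_le`, ★★ `dist1_nu_sideEdge_le`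
(`≤ s·2R·b` on the edges `a ∈ {0, 2R}`), ★★ `dist1_nu_topEdge_le` (`≤ (2R)²b + a·8R·b` on the edge `s = 2R`).  Every hypothesis is a plaquette bound on a face of the cube.
HONEST FRAMING.  Group bookkeeping; count-neutral helper toward R3 2′ (items 19936∕19935, `--supports stmt-QuantumFields-19936`); (S3) is completed by part 3; `hLift`∕(FL), the stub
`stub_laneRecordsV3Chi`, the crux `HistoryTailL` and the gap are NOT claimed; registry untouched; YM₃ on T³ is rung R3 of the YM ladder, not the Clay problem.

References: T. Bałaban, Commun. Math. Phys. 98 (1985) 17–51 [Balaban1985Averaging] ((8)–(9) p.18, (19)–(20) p.21, pp.24–25); Commun. Math. Phys. 99 (1985) 75–102 [Balaban1985RegularSpaces]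
(Lemma 1 (1.24)–(1.25) p.79).
-/

set_option autoImplicit false

namespace Summit.QuantumFields.YangMills.Theorems.SphereAxialGauge

open Literature.MathematicalPhysics.QuantumFieldTheory.Balaban1983to89

/-! ## §2 The top face: columns, the ring mismatch and its size (any gauge group) -/

section Top

variable {G : Type*} [GaugeGroup G] (W : ℤ → ℤ → ℤ → Fin 3 → G) (R : ℕ)

/-- **COLUMN TRANSPORTS ON THE TOP FACE**: `σ_col(a, s) := σ_T(a, 0, 2R) · W(Y^s)` from the ring site `(−R+a, −R, R)` up the top-face column. [cite: Balaban1985Averaging, pp.24–25] -/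
def sigmaCol (a s : ℕ) : G :=
  sigmaT W R a 0 (2 * R) * holY W (-(R : ℤ) + a) (-(R : ℤ)) (-(R : ℤ) + (2 * R : ℕ)) s

/-- **THE RING MISMATCH** `ν(a, s) := σ_T(a, s, 2R) · σ_col(a, s)⁻¹` (two gauges at the same top site; `= 1` on the edge `s = 0`). [cite: Balaban1985Averaging, (8) p.18] -/
def nu (a s : ℕ) : G := sigmaT W R a s (2 * R) * (sigmaCol W R a s)⁻¹

/-- **THE RUNG**: the `x`-bond of the top face gauged by the columns, `σ_col(a,s)·W_x·σ_col(a+1,s)⁻¹`. [cite: Balaban1985Averaging, (8) p.18] -/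
def rung (a s : ℕ) : G :=
  sigmaCol W R a s * W (-(R : ℤ) + a) (-(R : ℤ) + s) (-(R : ℤ) + (2 * R : ℕ)) 0 * (sigmaCol W R (a + 1) s)⁻¹

/-- Column bonds gauge to `1` under `σ_col`. [cite: Balaban1985Averaging, pp.24–25] -/
theorem sigmaCol_succ (a s : ℕ) : sigmaCol W R a (s + 1) = sigmaCol W R a s * W (-(R : ℤ) + a) (-(R : ℤ) + s) (-(R : ℤ) + (2 * R : ℕ)) 1 := by
  simp only [sigmaCol, holY_succ, mul_assoc]

/-- The gauged column bond is `1`. [cite: Balaban1985Averaging, pp.24–25] -/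
theorem gaugedCol_eq_one (a s : ℕ) : sigmaCol W R a s * W (-(R : ℤ) + a) (-(R : ℤ) + s) (-(R : ℤ) + (2 * R : ℕ)) 1 * (sigmaCol W R a (s + 1))⁻¹ = 1 := by
  rw [sigmaCol_succ]; group

/-- `ν(a, 0) = 1`. [folklore] -/
theorem nu_zero_s (a : ℕ) : nu W R a 0 = 1 := by
  simp only [nu, sigmaCol, holY, lprod, mul_one, mul_inv_cancel]

/-- **THE RUNG IS THIN**: `dist1(rung) ≤ s·b + 2R·b` — a `(y,x)`-ladder on the top face conjugated by `σ_T(a,0,2R)`, times the gauged `x`-bond of the ring edge `y = −R` (part 1).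
[cite: Balaban1985Averaging, (8)–(9) p.18, pp.24–25] -/
theorem dist1_rung_le (a s : ℕ) {b : ℝ}
    (hTop : ∀ i : ℕ, i < s → dist1 (pXY W (-(R : ℤ) + a) (-(R : ℤ) + i) (-(R : ℤ) + (2 * R : ℕ))) ≤ b)
    (hFoot : ∀ i : ℕ, i < 2 * R → dist1 (pXZ W (-(R : ℤ) + a) (-(R : ℤ)) (-(R : ℤ) + i)) ≤ b) :
    dist1 (rung W R a s) ≤ s * b + (2 * R : ℕ) * b := by
  have hlad := dist1_ladderYX_le W (-(R : ℤ) + a) (-(R : ℤ)) (-(R : ℤ) + (2 * R : ℕ)) s hTop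
  have hfoot := dist1_gaugedX_le W R a 0 (2 * R) (b := b) (fun i hi => by simpa only [Nat.cast_zero, add_zero] using hFoot i hi) (fun i hi => absurd hi (Nat.not_lt_zero i))
  simp only [Nat.cast_zero, add_zero, zero_mul] at hfoot
  have e : rung W R a s =
      sigmaT W R a 0 (2 * R) * (holY W (-(R : ℤ) + a) (-(R : ℤ)) (-(R : ℤ) + (2 * R : ℕ)) s * W (-(R : ℤ) + a) (-(R : ℤ) + s) (-(R : ℤ) + (2 * R : ℕ)) 0 *
          (holY W (-(R : ℤ) + a + 1) (-(R : ℤ)) (-(R : ℤ) + (2 * R : ℕ)) s)⁻¹ * (W (-(R : ℤ) + a) (-(R : ℤ)) (-(R : ℤ) + (2 * R : ℕ)) 0)⁻¹) * (sigmaT W R a 0 (2 * R))⁻¹ *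
        (sigmaT W R a 0 (2 * R) * W (-(R : ℤ) + a) (-(R : ℤ)) (-(R : ℤ) + (2 * R : ℕ)) 0 * (sigmaT W R (a + 1) 0 (2 * R))⁻¹) := by
    simp only [rung, sigmaCol, Nat.cast_succ, ← add_assoc]; group
  rw [e]
  calc _ ≤ dist1 (sigmaT W R a 0 (2 * R) * (holY W (-(R : ℤ) + a) (-(R : ℤ)) (-(R : ℤ) + (2 * R : ℕ)) s * W (-(R : ℤ) + a) (-(R : ℤ) + s) (-(R : ℤ) + (2 * R : ℕ)) 0 *
          (holY W (-(R : ℤ) + a + 1) (-(R : ℤ)) (-(R : ℤ) + (2 * R : ℕ)) s)⁻¹ * (W (-(R : ℤ) + a) (-(R : ℤ)) (-(R : ℤ) + (2 * R : ℕ)) 0)⁻¹) * (sigmaT W R a 0 (2 * R))⁻¹) +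
        dist1 (sigmaT W R a 0 (2 * R) * W (-(R : ℤ) + a) (-(R : ℤ)) (-(R : ℤ) + (2 * R : ℕ)) 0 * (sigmaT W R (a + 1) 0 (2 * R))⁻¹) := GaugeGroup.dist1_mul_le _ _
    _ ≤ s * b + (2 * R : ℕ) * b := by
        rw [GaugeGroup.dist1_conj]
        refine add_le_add ?_ hfoot
        simpa only [add_zero] using hlad

/-- One column step of the mismatch: `ν(a, s+1) · ν(a, s)⁻¹ = g⁻¹` with `g` the `σ_T`-gauged `y`-bond. [folklore] -/
theorem nu_succ_s_mul_inv (a s : ℕ) :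
    nu W R a (s + 1) * (nu W R a s)⁻¹ = (sigmaT W R a s (2 * R) * W (-(R : ℤ) + a) (-(R : ℤ) + s) (-(R : ℤ) + (2 * R : ℕ)) 1 * (sigmaT W R a (s + 1) (2 * R))⁻¹)⁻¹ := by
  rw [nu, nu, sigmaCol_succ]; group

/-- One row step of the mismatch: `ν(a+1, s) · ν(a, s)⁻¹ = g⁻¹ · (ν(a,s) · rung · ν(a,s)⁻¹)` with `g` the `σ_T`-gauged `x`-bond. [folklore] -/
theorem nu_succ_a_mul_inv (a s : ℕ) :
    nu W R (a + 1) s * (nu W R a s)⁻¹ =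
      (sigmaT W R a s (2 * R) * W (-(R : ℤ) + a) (-(R : ℤ) + s) (-(R : ℤ) + (2 * R : ℕ)) 0 * (sigmaT W R (a + 1) s (2 * R))⁻¹)⁻¹ * (nu W R a s * rung W R a s * (nu W R a s)⁻¹) := by
  rw [nu, nu, rung]; group

/-- **COLUMN STEP SIZE** (edges `a = 0`, `a = 2R` of the ring, where the `(y,z)`-ladder lies in a side face): `dist1(ν(a,s+1)·ν(a,s)⁻¹) ≤ 2R·b`. [cite: Balaban1985Averaging, pp.24–25] -/
theorem dist1_nu_succ_s_le (a s : ℕ) {b : ℝ} (hSide : ∀ i : ℕ, i < 2 * R → dist1 (pYZ W (-(R : ℤ) + a) (-(R : ℤ) + s) (-(R : ℤ) + i)) ≤ b) :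
    dist1 (nu W R a (s + 1) * (nu W R a s)⁻¹) ≤ (2 * R : ℕ) * b := by
  rw [nu_succ_s_mul_inv, GaugeGroup.dist1_inv]
  exact dist1_gaugedY_le W R a s (2 * R) hSide

/-- **ROW STEP SIZE** (edge `s = 2R`, where the `(x,z)`-ladder lies in the face `y = R`): `dist1(ν(a+1,s)·ν(a,s)⁻¹) ≤ ((2R + s) + (s + 2R))·b`. [cite: Balaban1985Averaging, pp.24–25] -/
theorem dist1_nu_succ_a_le (a s : ℕ) {b : ℝ}
    (hXZ : ∀ i : ℕ, i < 2 * R → dist1 (pXZ W (-(R : ℤ) + a) (-(R : ℤ) + s) (-(R : ℤ) + i)) ≤ b)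
    (hBot : ∀ i : ℕ, i < s → dist1 (pXY W (-(R : ℤ) + a) (-(R : ℤ) + i) (-(R : ℤ))) ≤ b)
    (hTop : ∀ i : ℕ, i < s → dist1 (pXY W (-(R : ℤ) + a) (-(R : ℤ) + i) (-(R : ℤ) + (2 * R : ℕ))) ≤ b)
    (hFoot : ∀ i : ℕ, i < 2 * R → dist1 (pXZ W (-(R : ℤ) + a) (-(R : ℤ)) (-(R : ℤ) + i)) ≤ b) :
    dist1 (nu W R (a + 1) s * (nu W R a s)⁻¹) ≤ ((2 * R : ℕ) * b + s * b) + (s * b + (2 * R : ℕ) * b) := by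
  have hg := dist1_gaugedX_le W R a s (2 * R) hXZ hBot
  have hr := dist1_rung_le W R a s hTop hFoot
  rw [nu_succ_a_mul_inv]
  calc _ ≤ dist1 ((sigmaT W R a s (2 * R) * W (-(R : ℤ) + a) (-(R : ℤ) + s) (-(R : ℤ) + (2 * R : ℕ)) 0 * (sigmaT W R (a + 1) s (2 * R))⁻¹)⁻¹) +
        dist1 (nu W R a s * rung W R a s * (nu W R a s)⁻¹) := GaugeGroup.dist1_mul_le _ _
    _ ≤ ((2 * R : ℕ) * b + s * b) + (s * b + (2 * R : ℕ) * b) := by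
        rw [GaugeGroup.dist1_inv, GaugeGroup.dist1_conj]; exact add_le_add hg hr

/-- **THE MISMATCH ON THE SIDE EDGES**: `dist1(ν(a, s)) ≤ s·(2R·b)` for `a ∈ {0, 2R}` (telescoping column steps from `ν(a,0) = 1`). [cite: Balaban1985Averaging, pp.24–25] -/
theorem dist1_nu_sideEdge_le (a : ℕ) {b : ℝ} (hSide : ∀ s i : ℕ, s < 2 * R → i < 2 * R → dist1 (pYZ W (-(R : ℤ) + a) (-(R : ℤ) + s) (-(R : ℤ) + i)) ≤ b) :
    ∀ s : ℕ, s ≤ 2 * R → dist1 (nu W R a s) ≤ s * ((2 * R : ℕ) * b)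
  | 0, _ => by rw [nu_zero_s, GaugeGroup.dist1_one]; simp
  | s + 1, hs => by
    have ih := dist1_nu_sideEdge_le a hSide s (by omega)
    have hstep := dist1_nu_succ_s_le W R a s (fun i hi => hSide s i (by omega) hi)
    have e : nu W R a (s + 1) = nu W R a (s + 1) * (nu W R a s)⁻¹ * nu W R a s := by group
    rw [e]
    calc _ ≤ dist1 (nu W R a (s + 1) * (nu W R a s)⁻¹) + dist1 (nu W R a s) := GaugeGroup.dist1_mul_le _ _
      _ ≤ (2 * R : ℕ) * b + s * ((2 * R : ℕ) * b) := add_le_add hstep ih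
      _ = ((s + 1 : ℕ) : ℝ) * ((2 * R : ℕ) * b) := by push_cast; ring

/-- **THE MISMATCH ON THE TOP EDGE** `s = 2R`: `dist1(ν(a, 2R)) ≤ 2R·(2R·b) + a·(8R·b)` (side edge `a = 0`, then telescoping row steps). [cite: Balaban1985Averaging, pp.24–25] -/
theorem dist1_nu_topEdge_le {b : ℝ}
    (hSide0 : ∀ s i : ℕ, s < 2 * R → i < 2 * R → dist1 (pYZ W (-(R : ℤ)) (-(R : ℤ) + s) (-(R : ℤ) + i)) ≤ b)
    (hXZ : ∀ a i : ℕ, a < 2 * R → i < 2 * R → dist1 (pXZ W (-(R : ℤ) + a) (-(R : ℤ) + (2 * R : ℕ)) (-(R : ℤ) + i)) ≤ b)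
    (hBot : ∀ a i : ℕ, a < 2 * R → i < 2 * R → dist1 (pXY W (-(R : ℤ) + a) (-(R : ℤ) + i) (-(R : ℤ))) ≤ b)
    (hTop : ∀ a i : ℕ, a < 2 * R → i < 2 * R → dist1 (pXY W (-(R : ℤ) + a) (-(R : ℤ) + i) (-(R : ℤ) + (2 * R : ℕ))) ≤ b)
    (hFoot : ∀ a i : ℕ, a < 2 * R → i < 2 * R → dist1 (pXZ W (-(R : ℤ) + a) (-(R : ℤ)) (-(R : ℤ) + i)) ≤ b) :
    ∀ a : ℕ, a ≤ 2 * R → dist1 (nu W R a (2 * R)) ≤ (2 * R : ℕ) * ((2 * R : ℕ) * b) + a * (4 * ((2 * R : ℕ) * b))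
  | 0, _ => by
    have h := dist1_nu_sideEdge_le W R 0 (by simpa only [Nat.cast_zero, add_zero] using hSide0) (2 * R) le_rfl
    simp only [Nat.cast_zero, add_zero, zero_mul] at h ⊢
    exact h
  | a + 1, ha => by
    have ih := dist1_nu_topEdge_le hSide0 hXZ hBot hTop hFoot a (by omega)
    have hstep := dist1_nu_succ_a_le W R a (2 * R) (fun i hi => hXZ a i (by omega) hi) (fun i hi => hBot a i (by omega) hi) (fun i hi => hTop a i (by omega) hi)
      (fun i hi => hFoot a i (by omega) hi)
    have e : nu W R (a + 1) (2 * R) = nu W R (a + 1) (2 * R) * (nu W R a (2 * R))⁻¹ * nu W R a (2 * R) := by group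
    rw [e]
    calc _ ≤ dist1 (nu W R (a + 1) (2 * R) * (nu W R a (2 * R))⁻¹) + dist1 (nu W R a (2 * R)) := GaugeGroup.dist1_mul_le _ _
      _ ≤ (((2 * R : ℕ) * b + (2 * R : ℕ) * b) + ((2 * R : ℕ) * b + (2 * R : ℕ) * b)) + ((2 * R : ℕ) * ((2 * R : ℕ) * b) + a * (4 * ((2 * R : ℕ) * b))) :=
          add_le_add hstep ih
      _ = (2 * R : ℕ) * ((2 * R : ℕ) * b) + ((a + 1 : ℕ) : ℝ) * (4 * ((2 * R : ℕ) * b)) := by push_cast; ring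

end Top

end Summit.QuantumFields.YangMills.Theorems.SphereAxialGauge
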